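import Literature.Topology.FourManifolds.BalancedPresentationBasisChangeProofs
import HarnessLib

/-!
# Generating `Aut F_k` by inner automorphisms and Nielsen moves known up to inner automorphisms

Topic `Literature/Topology/FourManifolds` (fact seat
`provefact-Literature.Topology.FourManifolds.lauden-f709dd520c`, Laudenbach–Poénaru's Lemma 2,
`laudenbachPoenaru_exists_diffeoExtends_mapOfEq_eq`).  Everything here is **proved**; no named
facts.

In the realisation of automorphisms of `π₁` of a `1`-handlebody by self-diffeomorphisms
(Laudenbach–Poénaru (1972), p. 339: "it suffices to realise `Φ₁, Φ₂, Φ₃`"), the diffeomorphism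
realising a handle slide is only known to induce the Nielsen move *up to an inner automorphism*
(a change of the path from the base point on the boundary down to the `0`-handle), whereas all
inner automorphisms are realised by pushing the base point around loops of the boundary.  The
group theory that makes this enough:

* `forall_conj_mem_of_forall_conj_of_mem` — a subgroup of `Aut F` containing the inner
  automorphisms `ι_{xᵢ}` of the basis elements contains all inner automorphisms;
* `closure_eq_top_of_conj_mul_nielsen_mem` — **if `S ⊆ Aut F_k` generates a subgroup containing
  every `ι_{xᵢ}` and, for every elementary Nielsen automorphism `ν`, some `ι_d ∘ ν`, then `S`
  generates `Aut F_k`** (by Nielsen's theorem, `autFreeGroup_eq_closure_nielsen_holds`).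

## References

* F. Laudenbach, V. Poénaru, *A note on 4-dimensional handlebodies*, Bull. Soc. Math. France
  100 (1972), 337–344, p. 339. [LaudenbachPoenaruBSMF1972]
* D. L. Johnson, *Presentations of Groups* (1997), Ch. 3 §4, Cor. 7. [Johnson1997]
-/

noncomputable section

namespace Literature.Topology.FourManifolds

open Set Function

variable {ι : Type*}

/-- **Inner automorphisms of generators suffice**: if a subgroup `H ≤ Aut F(ι)` contains the
conjugation `ι_{xᵢ} = (w ↦ xᵢ w xᵢ⁻¹)` by every basis element, it contains the conjugation by
every element of `F(ι)` (`MulAut.conj` is a homomorphism and the `xᵢ` generate). [folklore] -/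
theorem forall_conj_mem_of_forall_conj_of_mem (H : Subgroup (MulAut (FreeGroup ι)))
    (h : ∀ i : ι, MulAut.conj (FreeGroup.of i) ∈ H) (w : FreeGroup ι) : MulAut.conj w ∈ H := by
  have hle : (⊤ : Subgroup (FreeGroup ι)) ≤ H.comap (MulAut.conj : FreeGroup ι →* MulAut (FreeGroup ι)) := by
    rw [← FreeGroup.closure_range_of, Subgroup.closure_le]
    rintro _ ⟨i, rfl⟩
    exact h i
  exact hle (Subgroup.mem_top w)

/-- **Nielsen moves up to inner automorphisms, together with the inner automorphisms, generate
`Aut F_k`.**  Let `S ⊆ Aut F(x₀, …, x_{p-1})` be such that the subgroup it generates contains the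
inner automorphism `ι_{xᵢ}` of every basis element and, for every elementary Nielsen
automorphism `ν` (`nielsenGenerators p`: `xₖ ↦ xₖ⁻¹`, `xₖ ↦ xₖ xₗ`), an element of the form
`ι_d ∘ ν` for some `d ∈ F`.  Then `S` generates `Aut F_p`: `ν = ι_d⁻¹ ∘ (ι_d ∘ ν)` lies in the
subgroup, which therefore contains Nielsen's generating set
(`autFreeGroup_eq_closure_nielsen_holds`; Johnson (1997), Ch. 3 §4, Cor. 7).
[cite: Johnson1997, Ch. 3 §4 Cor. 7] [cite: LaudenbachPoenaruBSMF1972, §2, p. 339] -/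
theorem closure_eq_top_of_conj_mul_nielsen_mem {p : ℕ} (S : Set (MulAut (FreeGroup (Fin p))))
    (hconj : ∀ i : Fin p, MulAut.conj (FreeGroup.of i) ∈ Subgroup.closure S)
    (hN : ∀ ν ∈ nielsenGenerators p, ∃ d : FreeGroup (Fin p),
      MulAut.conj d * ν ∈ Subgroup.closure S) :
    Subgroup.closure S = ⊤ := by
  rw [eq_top_iff, ← autFreeGroup_eq_closure_nielsen_iff.1 autFreeGroup_eq_closure_nielsen_holds p,
    Subgroup.closure_le]
  intro ν hν
  obtain ⟨d, hd⟩ := hN ν hν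
  have hc : MulAut.conj d ∈ Subgroup.closure S :=
    forall_conj_mem_of_forall_conj_of_mem _ hconj d
  have h : (MulAut.conj d)⁻¹ * (MulAut.conj d * ν) = ν := inv_mul_cancel_left _ _
  rw [← h]
  exact Subgroup.mul_mem _ (Subgroup.inv_mem _ hc) hd

/-- Variant with the inner factor on the right: elements `ν ∘ ι_d`. [folklore] -/
theorem closure_eq_top_of_nielsen_mul_conj_mem {p : ℕ} (S : Set (MulAut (FreeGroup (Fin p))))
    (hconj : ∀ i : Fin p, MulAut.conj (FreeGroup.of i) ∈ Subgroup.closure S)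
    (hN : ∀ ν ∈ nielsenGenerators p, ∃ d : FreeGroup (Fin p),
      ν * MulAut.conj d ∈ Subgroup.closure S) :
    Subgroup.closure S = ⊤ := by
  refine closure_eq_top_of_conj_mul_nielsen_mem S hconj fun ν hν => ?_
  obtain ⟨d, hd⟩ := hN ν hν
  -- `ν ∘ ι_d = ι_{ν d} ∘ ν`
  refine ⟨ν d, ?_⟩
  have h : MulAut.conj (ν d) * ν = ν * MulAut.conj d := by
    ext w
    simp [MulAut.conj_apply, map_mul, map_inv]
  rw [h]
  exact hd

end Literature.Topology.FourManifolds
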